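import Summits.ResolutionOfSingularities.ResolutionOfSingularities.Theorems.HilbertSamuelEliminationSigmaMaxModificationsCorridor3WLadderIsoTailsFreeRational
import Summits.ResolutionOfSingularities.ResolutionOfSingularities.Theorems.HilbertSamuelEliminationSigmaMaxModificationsCorridor3WLadderIsoProximityDefs
import HarnessLib

/-!
# [OURS · L1 W4.2] D14 ROUTE H, object **H5 — THE FREE-RATIONAL STEP**, part 2/3: the DICTIONARY with the tower predicates
# `IsRationalStep` / `IsSatelliteStep` of Sketch C5 (`…Corridor3WLadderIsoProximityDefs`, p517256), and the FRAME SOCKET for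
# res-L1-w42-lead-1's H6(c) recursion (chart algebra typed `blowupAlgebra (maximalIdeal R) t`, point = a MAXIMAL ideal)
# (crux chain w42, line `w_ladder` v7, row `stub_Wtop3M_pointed`, kernel K1 `IsoFreeRationalTailsImpossible`;
# `--supports stmt-ResolutionOfSingularities-19249`, helper)

OURS (cell `res-hironaka`, slot ★L-G4 W4.2, hand res-type-071 for res-L1-w42-plan-1 RULINGS v3.14-4 (BH); spec =
res-L1-w42-lead-1's `D14-BRIDGE-CUT.md` sha16 `ca58498c1b3692f5`, ROUTE H row H5, and lead-1's interface line 2026-08-27T10:41:44Z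
«give the tower's point as a MAXIMAL ideal of `blowupAlgebra (maximalIdeal R_n) t` containing `t` and `r_i/t − ã_i`, and `R_{n+1}`
as ANY `IsLocalization.AtPrime` at it»). NOT a statement of H. Hironaka's manuscript [Hironaka2017] (under review in the cell,
unused here) nor of [CossartJannsenSaito2020] / [CossartPiltant2008]; AI-written, weaker than expert review. Sorry-free PROOF file: no
definitions, no named facts. Continues part 1/3 (`…IsoTailsFreeRational`).

## §6 Dictionary
* `map_maximalIdeal_stalkMap_eq_of_stalkIdeal` — from H4's exceptional-stalk clause (`𝓘(E)_{x′} = (g)`, `D_x = 𝔪_x`) to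
  `𝔪_x·𝒪_{X′,x′} = (g)`;
* `map_comp_stalkMap_eq_iff_forall_dvd` — **satellite dictionary (scheme level)**: for `x″ ↦ x′ ↦ x` with `𝔪_x·𝒪_{x′} = (g)` and
  generators `c′` of `𝔪_{x′}`: `𝔪_x·𝒪_{x″} = 𝔪_{x′}·𝒪_{x″}` iff `π′♯g ∣ π′♯c′_k` for all `k` (the point lies in the chart of the
  OLD exceptional parameter);
* `isRationalStep_iff` — `IsRationalStep T pt n ↔ κ(x_n) → κ(x_{n+1})` onto (`ResidueField.map` of the stalk map; `Iff.rfl`);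
* `not_isSatelliteStep_iff_forall_dvd` — `¬ IsSatelliteStep T pt n ↔` hypothesis (FREE) of `exists_origin_presentation` /
  `exists_maximalIdeal_presentation` for the step `n + 1` with `t = g`.

## §8 The frame socket
* `isMaximal_origin_blowupAlgebra` — the origin of the chart is a maximal ideal of `R[𝔪/c_j]`;
* `gen_sub_mul_eq` — `(x − a t)/t = x/t − a` in `R[I/t]`;
* `exists_maximalIdeal_presentation` — **the step in lead-1's currency**: under (FREE) at `t = c_j` and (RAT), lifts `ã` and a
  MAXIMAL ideal `𝔑` of `blowupAlgebra (maximalIdeal R) t` with `t/1 ∈ 𝔑`, `c_k/t − ã_k ∈ 𝔑` (`k ≠ j`), `𝔑 ∩ R = 𝔪`;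
  `R′ = R[𝔪/t]_𝔑` regular local with `μ(𝔪_{R′}) = d` and r.s.p. `(t/1, (c_k/t − ã_k)/1)`, `R → κ(R′)` onto; the strict
  transform `h′ ∈ 𝔑` with `h/1 = (t/1)^m·h′` (`t/1` prime, `∤ h′`); a surjection `σ′ : R′ ↠ 𝒪_{X′,x′}` with `ker σ′ = (h′/1)`
  extending `π♯ ∘ σ`; `𝓘(E)_{x′} = (π♯σ(t))`, `π♯σ(t)` a non-zero-divisor. Obtained from part 1's `exists_origin_presentation` by
  transport along `span (range c̃) = 𝔪`, `c̃_j = t` (generalisation over the ideal and the parameter).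

Part 3/3 (`…IsoTailsFreeRationalTower`): the forms with the base point named by an equation / along a `BlowupTower`.

## References
* V. Cossart, O. Piltant, J. Algebra 320 (2008), proof of Lemma 4.3 (3). [CossartPiltant2008]
* U. Görtz, T. Wedhorn, *Algebraic Geometry I*, 2nd ed. (2020), (13.19), Prop. 13.91, Prop. 13.96 (2). [GortzWedhorn2020]
* V. Cossart, U. Jannsen, S. Saito, LNM 2270 (2020), Def. 6.34 (6.25) (towers). [CossartJannsenSaito2020]
-/

noncomputable section

-- the mandated cell namespace `Summit.ResolutionOfSingularities.ResolutionOfSingularities.…` re-enters the summit name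
set_option linter.dupNamespace false

open CategoryTheory AlgebraicGeometry TopologicalSpace IsLocalRing
open Literature.AlgebraicGeometry.Resolution
open Summit.ResolutionOfSingularities.ResolutionOfSingularities.Cruxes.SigmaMaxModifications.IdeasL1C5
  (IsRationalStep IsSatelliteStep)

namespace Summit.ResolutionOfSingularities.ResolutionOfSingularities.Cruxes.SigmaMaxModifications.IdeasL1C5.EmbeddedStep

universe u

/-! ## §6. The DICTIONARY with the tower predicates of Sketch C5 (`IsRationalStep`, `IsSatelliteStep`, p517256) -/

section Dictionary

variable {X'' X' X : Scheme.{u}}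

/-- From H4's exceptional-stalk clause to the form the satellite dictionary consumes: if `D_x = 𝔪_x` and
`𝓘(E)_{x′} = (D·𝒪_{X′})_{x′} = (g)`, then `𝔪_x · 𝒪_{X′,x′} = (g)`. [folklore] -/
theorem map_maximalIdeal_stalkMap_eq_of_stalkIdeal (π : X' ⟶ X) (D : X.IdealSheafData) (x' : X')
    (hD : stalkIdeal D (π x') = maximalIdeal (X.presheaf.stalk (π x'))) {g : X'.presheaf.stalk x'}
    (hE : stalkIdeal (D.comap π) x' = Ideal.span {g}) :
    (maximalIdeal (X.presheaf.stalk (π x'))).map (π.stalkMap x').hom = Ideal.span {g} := by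
  rw [← hD, ← stalkIdeal_comap_eq_map_stalkMap, hE]

/-- **SATELLITE DICTIONARY (scheme level).** For `x″ ↦ x′ ↦ x` along `π′`, `π` with `𝔪_x·𝒪_{X′,x′} = (g)` (the exceptional
parameter at `x′`, e.g. `g = π♯σ(t)` from `exists_stalk_presentation`) and generators `c′` of `𝔪_{x′}`: the two pulled-back
ideals `𝔪_x·𝒪_{X″,x″}` and `𝔪_{x′}·𝒪_{X″,x″}` COINCIDE (`x″` is NOT proximate to `x`: not a satellite step) iff `π′♯g`
divides every `π′♯(c′_k)` — i.e. iff `x″` lies in the chart of the OLD exceptional parameter `g` of `Bl_{x′}` (hypothesis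
(FREE) of `exists_origin_presentation` at the next step). [folklore] -/
theorem map_comp_stalkMap_eq_iff_forall_dvd (π' : X'' ⟶ X') (π : X' ⟶ X) (x'' : X'')
    {g : X'.presheaf.stalk (π' x'')}
    (hE : (maximalIdeal (X.presheaf.stalk (π (π' x'')))).map (π.stalkMap (π' x'')).hom = Ideal.span {g})
    {ι : Type*} {c' : ι → X'.presheaf.stalk (π' x'')}
    (hc' : Ideal.span (Set.range c') = maximalIdeal (X'.presheaf.stalk (π' x''))) :
    Ideal.map ((π' ≫ π).stalkMap x'').hom (maximalIdeal _) = Ideal.map (π'.stalkMap x'').hom (maximalIdeal _) ↔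
      ∀ k, (π'.stalkMap x'').hom g ∣ (π'.stalkMap x'').hom (c' k) := by
  haveI : IsLocalHom (π.stalkMap (π' x'')).hom := π.toLRSHom.prop _
  have hcomp : ((π' ≫ π).stalkMap x'').hom = (π'.stalkMap x'').hom.comp (π.stalkMap (π' x'')).hom := by
    rw [Scheme.Hom.stalkMap_comp]
    rfl
  have hL : Ideal.map ((π' ≫ π).stalkMap x'').hom (maximalIdeal _) = Ideal.span {(π'.stalkMap x'').hom g} := by
    have e : Ideal.map ((π' ≫ π).stalkMap x'').hom (maximalIdeal (X.presheaf.stalk (π (π' x'')))) =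
        ((maximalIdeal _).map (π.stalkMap (π' x'')).hom).map (π'.stalkMap x'').hom := by
      rw [Ideal.map_map, ← hcomp]
      exact rfl
    refine e.trans ?_
    rw [hE, Ideal.map_span, Set.image_singleton]
  have hR : Ideal.map (π'.stalkMap x'').hom (maximalIdeal _) =
      Ideal.span (Set.range fun k => (π'.stalkMap x'').hom (c' k)) := by
    rw [← hc', Ideal.map_span, ← Set.range_comp]
    rfl
  rw [hL, hR]
  constructor
  · intro h k
    have hk : (π'.stalkMap x'').hom (c' k) ∈ Ideal.span {(π'.stalkMap x'').hom g} := by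
      rw [h]; exact Ideal.subset_span ⟨k, rfl⟩
    exact Ideal.mem_span_singleton.mp hk
  · intro h
    apply le_antisymm
    · rw [Ideal.span_singleton_le_iff_mem]
      have hg : g ∈ maximalIdeal (X'.presheaf.stalk (π' x'')) := by
        have : g ∈ Ideal.span {g} := Ideal.mem_span_singleton_self g
        rw [← hE] at this
        exact IsLocalRing.map_maximalIdeal_le _ this
      rw [← hc'] at hg
      have h2 := Ideal.mem_map_of_mem (π'.stalkMap x'').hom hg
      rwa [Ideal.map_span, ← Set.range_comp] at h2
    · rw [Ideal.span_le]
      rintro _ ⟨k, rfl⟩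
      exact Ideal.mem_span_singleton.mpr (h k)

open Literature.AlgebraicGeometry.CossartJannsenSaito2020

/-- **`IsRationalStep` unfolded**: the step `X_{n+1} → X_n` of the tower is RATIONAL at `x_{n+1}` iff
`κ(x_n) → κ(x_{n+1})` — Mathlib's `ResidueField.map` of the stalk map — is onto (hypothesis (RAT) of
`exists_origin_presentation`). [folklore] -/
theorem isRationalStep_iff (T : BlowupTower.{u}) (pt : ∀ n, T.X n) (n : ℕ) :
    IsRationalStep T pt n ↔
      Function.Surjective (IsLocalRing.ResidueField.map ((T.π n).stalkMap (pt (n + 1))).hom) :=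
  Iff.rfl

/-- **`¬ IsSatelliteStep` unfolded** (tower form of `map_comp_stalkMap_eq_iff_forall_dvd`): with `𝔪_{x_n}·𝒪_{x_{n+1}} = (g)`
(read at the point `π_{n+1}(x_{n+2})`) and generators `c′` of `𝔪_{x_{n+1}}`, the step `n` is NOT a satellite step iff
`π_{n+1}♯ g ∣ π_{n+1}♯ c′_k` for all `k` — hypothesis (FREE) of `exists_origin_presentation` for the step `n + 1` with `t = g`.
[folklore] -/
theorem not_isSatelliteStep_iff_forall_dvd (T : BlowupTower.{u}) (pt : ∀ n, T.X n) (n : ℕ)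
    {g : (T.X (n + 1)).presheaf.stalk ((T.π (n + 1)) (pt (n + 2)))}
    (hE : (maximalIdeal ((T.X n).presheaf.stalk ((T.π n) ((T.π (n + 1)) (pt (n + 2)))))).map
      ((T.π n).stalkMap ((T.π (n + 1)) (pt (n + 2)))).hom = Ideal.span {g})
    {ι : Type*} {c' : ι → (T.X (n + 1)).presheaf.stalk ((T.π (n + 1)) (pt (n + 2)))}
    (hc' : Ideal.span (Set.range c') = maximalIdeal _) :
    ¬ IsSatelliteStep T pt n ↔
      ∀ k, ((T.π (n + 1)).stalkMap (pt (n + 2))).hom g ∣ ((T.π (n + 1)).stalkMap (pt (n + 2))).hom (c' k) := by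
  rw [IsSatelliteStep, not_not]
  exact map_comp_stalkMap_eq_iff_forall_dvd (T.π (n + 1)) (T.π n) (pt (n + 2)) hE hc'

end Dictionary

/-! ## §8. THE FRAME SOCKET (res-L1-w42-lead-1's H6(c) recursion, `…IsoTailsFormalFrameTower`): the same step with the chart
algebra typed `blowupAlgebra (maximalIdeal R) t` and the point given as a MAXIMAL ideal `𝔑 ∋ t/1, c_k/t − ã_k` -/

section FrameSocket

variable {R : Type u} [CommRing R] {d : ℕ} (c : Fin d → R) (j : Fin d)

/-- The origin of the chart is a MAXIMAL ideal of `R[𝔪/c_j]` (residue field `R/𝔪`; the tree's `isMaximal_origin` transported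
along the bridge). [cite: CossartPiltant2008, proof of Lemma 4.3 (3)] -/
theorem isMaximal_origin_blowupAlgebra [IsLocalRing R]
    (𝔔 : Ideal (blowupAlgebra (Ideal.span (Set.range c)) (c j))) [𝔔.IsPrime]
    (h𝔔 : 𝔔.comap (algebraMap R (blowupAlgebra (Ideal.span (Set.range c)) (c j))) = maximalIdeal R)
    (he : ∀ k, k ≠ j → blowupAlgebra.frac c j k ∈ 𝔔) : 𝔔.IsMaximal := by
  haveI : (𝔔.comap (blowupAlgebra.toBlowupAlgebra c j)).IsPrime := Ideal.comap_isPrime _ _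
  have hcomp : (blowupAlgebra.toBlowupAlgebra c j).comp (chartBase c j) =
      algebraMap R (blowupAlgebra (Ideal.span (Set.range c)) (c j)) :=
    RingHom.ext fun r => blowupAlgebra.toBlowupAlgebra_reesChartBase c j r
  have h𝔴 : (𝔔.comap (blowupAlgebra.toBlowupAlgebra c j)).comap (chartBase c j) = maximalIdeal R := by
    rw [Ideal.comap_comap, hcomp, h𝔔]
  have he' : ∀ i, i ≠ j → chartGen c j i ∈ 𝔔.comap (blowupAlgebra.toBlowupAlgebra c j) := fun i hi => by
    rw [Ideal.mem_comap, blowupAlgebra.toBlowupAlgebra_chartGen]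
    exact he i hi
  have hmax := isMaximal_origin c j (𝔔.comap (blowupAlgebra.toBlowupAlgebra c j)) h𝔴 he'
  exact (Ideal.isMaximal_comap_iff_of_bijective _ (blowupAlgebra.toBlowupAlgebra_bijective c j)).mp hmax

/-- In `R[I/t] ⊆ R[1/t]`: `(x − a·t)/t = x/t − a`. [folklore] -/
theorem gen_sub_mul_eq (I : Ideal R) (t : R) (ht : t ∈ I) {x : R} (hx : x ∈ I) (a : R)
    (hxa : x - a * t ∈ I) :
    blowupAlgebra.gen I t (x - a * t) hxa = blowupAlgebra.gen I t x hx - algebraMap R _ a := by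
  have h1 : blowupAlgebra.gen I t (x - a * t) hxa + algebraMap R _ a * blowupAlgebra.gen I t t ht =
      blowupAlgebra.gen I t x hx := by
    rw [← blowupAlgebra.gen_mul_left, ← blowupAlgebra.gen_add]
    congr 1
    ring
  rw [blowupAlgebra.gen_self, mul_one] at h1
  rw [← h1, add_sub_cancel_right]

variable {X X' : Scheme.{u}} {π : X' ⟶ X} {D : X.IdealSheafData}

set_option maxHeartbeats 1600000 in
-- long existential packaging over the affine blowup algebra of a stalk (as in `BlowupStalkBlowupAlgebra.lean`)
/-- **H5 — THE FRAME SOCKET.** `exists_origin_presentation` re-typed for res-L1-w42-lead-1's H6(c) recursion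
(`FormalFrame.stepLift/stepPrime/stepFrame`, `span_le_stepPrime`, `eq_stepPrime_of_isMaximal_of_le`): the chart algebra is
literally `blowupAlgebra (maximalIdeal R) t` with `t = c_{j₀}` (the SAME `t` along a free-rational tail), the point `x′` is a
MAXIMAL ideal `𝔑` of it containing `t/1` and the translated coordinates `c_k/t − ã_k` (`k ≠ j₀`), `R′ = R[𝔪/t]_𝔑` is regular
local of embedding dimension `d` with regular system of parameters `(t/1, (c_k/t − ã_k)/1)`, `R → κ(R′)` is onto, the strict
transform satisfies `h/1 = (t/1)^m · h′` with `𝒪_{X′,x′} ≅ R′/(h′)` through the surjection `σ′` extending `π♯ ∘ σ`, and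
`𝓘(E)_{x′} = (π♯σ(t))` with `π♯σ(t)` a non-zero-divisor (feed `not_isSatelliteStep_iff_forall_dvd` at the next step).
Hypotheses: (FREE) `π♯σ(t) ∣ π♯σ(c_k)` and (RAT) `κ(x) → κ(x′)` onto. [cite: CossartPiltant2008, proof of Lemma 4.3 (3);
GortzWedhorn2020, Prop. 13.96 (2)] -/
theorem exists_maximalIdeal_presentation (hπ : IsBlowup π D) (x' : X')
    (hD : stalkIdeal D (π x') = maximalIdeal (X.presheaf.stalk (π x')))
    [IsRegularLocalRing R] (hd : (maximalIdeal R).spanFinrank = d)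
    (hc : Ideal.span (Set.range c) = maximalIdeal R)
    (σ : R →+* X.presheaf.stalk (π x')) (hσ : Function.Surjective σ) {h : R}
    (hker : RingHom.ker σ = Ideal.span {h}) {m : ℕ} (hm : h ∈ maximalIdeal R ^ m)
    (hm' : h ∉ maximalIdeal R ^ (m + 1))
    (hfree : ∀ k, (π.stalkMap x').hom (σ (c j)) ∣ (π.stalkMap x').hom (σ (c k)))
    (hrat : Function.Surjective (IsLocalRing.ResidueField.map (π.stalkMap x').hom)) :
    ∃ (a : {k : Fin d // k ≠ j} → R) (𝔑 : Ideal (blowupAlgebra (maximalIdeal R) (c j))) (_ : 𝔑.IsMaximal)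
      (h' : blowupAlgebra (maximalIdeal R) (c j))
      (σ' : Localization.AtPrime 𝔑 →+* X'.presheaf.stalk x'),
      algebraMap R _ h = algebraMap R _ (c j) ^ m * h' ∧
      Prime (algebraMap R (blowupAlgebra (maximalIdeal R) (c j)) (c j)) ∧
      ¬ algebraMap R (blowupAlgebra (maximalIdeal R) (c j)) (c j) ∣ h' ∧
      𝔑.comap (algebraMap R _) = maximalIdeal R ∧
      h' ∈ 𝔑 ∧
      algebraMap R (blowupAlgebra (maximalIdeal R) (c j)) (c j) ∈ 𝔑 ∧
      (∀ k (hk : k ≠ j), blowupAlgebra.gen (maximalIdeal R) (c j) (c k) (hc.le (Ideal.subset_span ⟨k, rfl⟩)) -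
        algebraMap R _ (a ⟨k, hk⟩) ∈ 𝔑) ∧
      IsRegularLocalRing (Localization.AtPrime 𝔑) ∧
      (maximalIdeal (Localization.AtPrime 𝔑)).spanFinrank = d ∧
      Ideal.span (Set.range fun k : Fin d =>
        if hk : k = j then algebraMap _ (Localization.AtPrime 𝔑) (algebraMap R (blowupAlgebra (maximalIdeal R) (c j)) (c j))
        else algebraMap _ (Localization.AtPrime 𝔑)
          (blowupAlgebra.gen (maximalIdeal R) (c j) (c k) (hc.le (Ideal.subset_span ⟨k, rfl⟩)) -
            algebraMap R _ (a ⟨k, hk⟩))) = maximalIdeal (Localization.AtPrime 𝔑) ∧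
      Function.Surjective σ' ∧
      RingHom.ker σ' = Ideal.span {algebraMap _ (Localization.AtPrime 𝔑) h'} ∧
      (∀ r : R, σ' (algebraMap _ (Localization.AtPrime 𝔑) (algebraMap R (blowupAlgebra (maximalIdeal R) (c j)) r)) =
        (π.stalkMap x').hom (σ r)) ∧
      (π.stalkMap x').hom (σ (c j)) ∈ nonZeroDivisors (X'.presheaf.stalk x') ∧
      stalkIdeal (D.comap π) x' = Ideal.span {(π.stalkMap x').hom (σ (c j))} ∧
      Function.Surjective ((IsLocalRing.residue (Localization.AtPrime 𝔑)).comp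
        ((algebraMap _ (Localization.AtPrime 𝔑)).comp (algebraMap R (blowupAlgebra (maximalIdeal R) (c j))))) := by
  classical
  obtain ⟨a, 𝔔, h', σ', h1, h2, h3, h4, h5, h6, h7, h8, h9, -, h11, h12, h13, h14, h15, h16⟩ :=
    exists_origin_presentation hπ x' hD hd c hc σ hσ hker hm hm' j hfree hrat
  refine ⟨a, ?_⟩
  -- the shifted system: ideal `𝔪`, exceptional parameter `c_j`
  have hI : Ideal.span (Set.range (shiftRsop c j a)) = maximalIdeal R := by rw [span_range_shiftRsop, hc]
  have ht : shiftRsop c j a j = c j := shiftRsop_self c j a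
  have hmax : 𝔔.asIdeal.IsMaximal := isMaximal_origin_blowupAlgebra (shiftRsop c j a) j 𝔔.asIdeal h4 h13
  -- transport along the (propositional) equalities `span (range c̃) = 𝔪`, `c̃_j = c_j` by generalisation
  have key : ∀ (I : Ideal R) (t : R), Ideal.span (Set.range (shiftRsop c j a)) = I → shiftRsop c j a j = t →
      ∀ (hck : ∀ k, c k ∈ I),
      ∃ (𝔑 : Ideal (blowupAlgebra I t)) (_ : 𝔑.IsMaximal) (h' : blowupAlgebra I t)
        (σ' : Localization.AtPrime 𝔑 →+* X'.presheaf.stalk x'),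
        algebraMap R _ h = algebraMap R _ t ^ m * h' ∧
        Prime (algebraMap R (blowupAlgebra I t) t) ∧
        ¬ algebraMap R (blowupAlgebra I t) t ∣ h' ∧
        𝔑.comap (algebraMap R _) = maximalIdeal R ∧
        h' ∈ 𝔑 ∧
        algebraMap R (blowupAlgebra I t) t ∈ 𝔑 ∧
        (∀ k (hk : k ≠ j), blowupAlgebra.gen I t (c k) (hck k) - algebraMap R _ (a ⟨k, hk⟩) ∈ 𝔑) ∧
        IsRegularLocalRing (Localization.AtPrime 𝔑) ∧
        (maximalIdeal (Localization.AtPrime 𝔑)).spanFinrank = d ∧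
        Ideal.span (Set.range fun k : Fin d =>
          if hk : k = j then algebraMap _ (Localization.AtPrime 𝔑) (algebraMap R (blowupAlgebra I t) t)
          else algebraMap _ (Localization.AtPrime 𝔑)
            (blowupAlgebra.gen I t (c k) (hck k) - algebraMap R _ (a ⟨k, hk⟩))) =
          maximalIdeal (Localization.AtPrime 𝔑) ∧
        Function.Surjective σ' ∧
        RingHom.ker σ' = Ideal.span {algebraMap _ (Localization.AtPrime 𝔑) h'} ∧
        (∀ r : R, σ' (algebraMap _ (Localization.AtPrime 𝔑) (algebraMap R (blowupAlgebra I t) r)) =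
          (π.stalkMap x').hom (σ r)) ∧
        (π.stalkMap x').hom (σ t) ∈ nonZeroDivisors (X'.presheaf.stalk x') ∧
        stalkIdeal (D.comap π) x' = Ideal.span {(π.stalkMap x').hom (σ t)} ∧
        Function.Surjective ((IsLocalRing.residue (Localization.AtPrime 𝔑)).comp
          ((algebraMap _ (Localization.AtPrime 𝔑)).comp (algebraMap R (blowupAlgebra I t)))) := by
    intro I t hI' ht' hck
    subst hI' ht'
    -- the translated coordinates are the chart generators of the shifted system
    have hgen : ∀ k (hk : k ≠ j),
        blowupAlgebra.gen (Ideal.span (Set.range (shiftRsop c j a))) (shiftRsop c j a j) (c k) (hck k) -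
          algebraMap R _ (a ⟨k, hk⟩) = blowupAlgebra.frac (shiftRsop c j a) j k := by
      intro k hk
      have hxa : c k - a ⟨k, hk⟩ * shiftRsop c j a j ∈ Ideal.span (Set.range (shiftRsop c j a)) := by
        rw [shiftRsop_self, ← shiftRsop_of_ne c j a hk]
        exact blowupAlgebra.mem_span_range _ k
      rw [← gen_sub_mul_eq (Ideal.span (Set.range (shiftRsop c j a))) (shiftRsop c j a j)
        (blowupAlgebra.mem_span_range _ j) (hck k) (a ⟨k, hk⟩) hxa]
      unfold blowupAlgebra.frac
      congr 1
      rw [shiftRsop_of_ne c j a hk, shiftRsop_self]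
    have htj : algebraMap R (blowupAlgebra (Ideal.span (Set.range (shiftRsop c j a))) (shiftRsop c j a j))
        (shiftRsop c j a j) ∈ 𝔔.asIdeal := by
      rw [← Ideal.mem_comap, h4, ← hc, shiftRsop_self]
      exact Ideal.subset_span ⟨j, rfl⟩
    have hfam : (fun k : Fin d =>
        if hk : k = j then algebraMap _ (Localization.AtPrime 𝔔.asIdeal)
          (algebraMap R (blowupAlgebra (Ideal.span (Set.range (shiftRsop c j a))) (shiftRsop c j a j)) (shiftRsop c j a j))
        else algebraMap _ (Localization.AtPrime 𝔔.asIdeal)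
          (blowupAlgebra.gen (Ideal.span (Set.range (shiftRsop c j a))) (shiftRsop c j a j) (c k) (hck k) -
            algebraMap R _ (a ⟨k, hk⟩))) =
        (fun k : Fin d =>
        if k = j then algebraMap _ (Localization.AtPrime 𝔔.asIdeal)
          (algebraMap R (blowupAlgebra (Ideal.span (Set.range (shiftRsop c j a))) (shiftRsop c j a j)) (shiftRsop c j a j))
        else algebraMap _ (Localization.AtPrime 𝔔.asIdeal) (blowupAlgebra.frac (shiftRsop c j a) j k)) := by
      funext k
      by_cases hk : k = j
      · rw [dif_pos hk, if_pos hk]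
      · rw [dif_neg hk, if_neg hk, hgen k hk]
    refine ⟨𝔔.asIdeal, hmax, h', σ', h1, h2, h3, h4, h5, htj, fun k hk => ?_, h6, h14, ?_, h7, h8, h9, h11, h12,
      h16⟩
    · rw [hgen k hk]; exact h13 k hk
    · rw [hfam]; exact h15
  exact key (maximalIdeal R) (c j) hI ht fun k => hc.le (Ideal.subset_span ⟨k, rfl⟩)

end FrameSocket

end Summit.ResolutionOfSingularities.ResolutionOfSingularities.Cruxes.SigmaMaxModifications.IdeasL1C5.EmbeddedStep

end
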